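import Summits.SmoothPoincare4.SmoothPoincare4.Theorems.ConvexBisectionAcyclicBisectionExistsDualHandleModelDeriv
import HarnessLib

/-!
# Dual handles, XV: the model of the dual handle embedding is an open smooth embedding
(brick (F-emb) = (F-inv) of the sub-goal T3b "the complement of the prefix sub-handlebody is the
other piece with the DUAL suffix handles" of stub `stub_steinRealisation` (NF6), line
`modp-braid-orbits` r11, crux `ConvexBisection.AcyclicBisectionExists`, item
stmt-SmoothPoincare4-10508; wave 3, lead c5)

Conclusion of `…DualHandleModelEmbDom.lean` (injectivity of `𝓕 = modelF a κ δ` on the open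
embedding domain `Ω = {s < 1, u < 1 + 1/(2(a+1))} ⊇ {‖z‖ ≤ 1, ‖z_λ‖ < 1}`) and
`…DualHandleModelDeriv.lean` (structure of `d𝓕`, kernel vectors have parallel parts, stationary
part-norms):

* `cl_mul_sOf_eq_zero` — **the zone analysis**: for a kernel vector `v` (`v_λ = c_λ z_λ`) one has
  `c_λ s = 0`.  Along `z + t v`, `s(t) = (1 + t c_λ)² s` and the squared `μ`-norm `Q(t)` of `𝓕` is
  stationary; for `s < 1/2` it is `δ s(t)` (derivative `2 δ c_λ s`); for `s ≥ 1/2` it is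
  `qHat(P(t), s(t)) = ω(s)(1 + g(δ(s - P/κ²)) - P) + (1 - ω(s)) δ s` with `P(t)` stationary too, so
  its derivative is `2 c_λ s · [ω'(F - δ s) + ω g' δ + (1 - ω) δ]`, and the bracket is `> 0`
  (`ω' ≥ 0`, `F - δ s ≥ 5/8 - 1/2`, `g' > 0`) — the infinitesimal form of `qHat_lt_qHat`;
* `ker_fderiv_modelF_eq_zero`, **`exists_equiv_hasFDerivAt_modelF`** — the differential of `𝓕`
  is invertible at every point of `Ω` (`injective_fderiv_modelF`);
* **`exists_openPartialHomeomorph_modelF`** — `𝓕|Ω` is a diffeomorphism onto an open set: an open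
  partial homeomorphism of `ℝ⁴` with source `Ω`, `C^∞` with `C^∞` inverse (the tree's
  `exists_openPartialHomeomorph_of_injOn`: inverse function theorem glued along injectivity);
  `isOpen_image_modelF`;
* **`isSmoothEmbedding_modelF`** — for every non-empty open `U ⊆ Ω`, `fun x : U => 𝓕 x` is a smooth
  embedding `𝓘(ℝ, ℝ⁴) → 𝓘(ℝ, ℝ⁴)` with OPEN range — the shape of `isSmoothEmbedding_modelChart`, so
  that `Ξ ∘ 𝓕` (the dual handle embedding of T3b read in Milnor's gluing) is a composite of open
  smooth embeddings;
* `helper_isSmoothEmbedding_modelF` (registered).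

Everything here is proved; no named facts.

## References
* J. Milnor, *Lectures on the h-cobordism theorem* (1965), §3. [MilnorHCobordism1965]
* J. M. Lee, *Introduction to Smooth Manifolds* (2013), Thm. 4.5 (inverse function theorem),
  Prop. 5.2. [LeeSmoothManifolds2013]
-/

noncomputable section

-- the prescribed namespace `Summit.<P>.<Sub>.…` duplicates `SmoothPoincare4` (P = Sub)
set_option linter.dupNamespace false

open scoped Manifold ContDiff Topology

namespace Summit.SmoothPoincare4.SmoothPoincare4.Theorems.AcyclicBisectionExists.ModpBraidOrbits

open Set Function Metric Filter Topology
open Literature.Topology.FourManifolds Literature.Topology.FourManifolds.HandleAttachingMap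

/-! ### §1 The zone analysis: `c_λ s = 0` for kernel vectors -/

section Zones

/-- **THE ZONE ANALYSIS.**  For `z` in the embedding domain (`0 < a`, `0 < κ ≤ 1/2`, `0 < δ ≤ 1/2`)
and a kernel vector `v` of a derivative `F'` of `𝓕` at `z` with parts `v_λ = c_λ z_λ`,
`v_μ = c_μ z_μ`: `c_λ · s(z) = 0`. [cite: MilnorHCobordism1965, §3] -/
theorem cl_mul_sOf_eq_zero {a κ δ : ℝ} (ha : 0 < a) (hκ : 0 < κ) (hκ2 : κ ≤ 1 / 2) (hδ : 0 < δ)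
    (hδ2 : δ ≤ 1 / 2) {z : EuclideanSpace ℝ (Fin 4)}
    (hz : z ∈ {z : EuclideanSpace ℝ (Fin 4) | sOf z < 1 ∧ uOf z < 1 + 1 / (2 * (a + 1))})
    {F' : EuclideanSpace ℝ (Fin 4) →L[ℝ] EuclideanSpace ℝ (Fin 4)}
    (hF : HasFDerivAt (modelF a κ δ) F' z) {v : EuclideanSpace ℝ (Fin 4)} (hv : F' v = 0)
    {cl cm : ℝ} (hvl : lamPart v = cl • lamPart z) (hvm : muPart v = cm • muPart z) :
    cl * sOf z = 0 := by
  obtain ⟨hPc, hQc⟩ := hasDerivAt_parts_of_ker hF hv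
  have hvm' := hvm
  -- the polynomial `S t = (1 + t c_λ)² s` and its derivative `2 c_λ s` at `0`
  set S : ℝ → ℝ := fun t => (1 + t * cl) ^ 2 * sOf z with hS
  have hS0 : S 0 = sOf z := by simp [hS]
  have hSt : ∀ t, sOf (z + t • v) = S t := fun t => sOf_line hvl t
  have hSd : HasDerivAt S (2 * cl * sOf z) 0 := by
    have h := ((((hasDerivAt_id' (0 : ℝ)).mul_const cl).const_add 1).fun_pow 2).mul_const (sOf z)
    refine h.congr_deriv ?_
    simp only [Nat.cast_ofNat, zero_mul, add_zero, one_mul]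
    ring
  have hγ : Continuous fun t : ℝ => z + t • v := by fun_prop
  have hsc : Continuous fun t : ℝ => sOf (z + t • v) := contDiff_sOf.continuous.comp hγ
  rcases lt_or_ge (sOf z) (1 / 2) with hlow | hhigh
  · -- ZONE I (`s < 1/2`): near `t = 0`, `Q(t) = δ S t`
    have hev : ∀ᶠ t in 𝓝 (0 : ℝ), sOf (z + t • v) < 1 / 2 :=
      hsc.continuousAt.eventually_lt continuousAt_const (by simpa using hlow)
    have hQev : (fun t : ℝ => ‖muPart (modelF a κ δ (z + t • v))‖ ^ 2) =ᶠ[𝓝 0]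
        fun t => δ * S t := by
      filter_upwards [hev] with t ht
      have hq : 0 < qTilde a κ δ (sOf (z + t • v)) (uOf (z + t • v)) := by
        rw [qTilde_of_le a κ δ ht.le]; exact hδ
      rw [norm_muPart_modelF_sq hq, qTilde_of_le a κ δ ht.le, hSt t]; ring
    have h0 : δ * (2 * cl * sOf z) = 0 := ((hSd.const_mul δ).congr_of_eventuallyEq hQev).unique hQc
    rcases mul_eq_zero.1 h0 with h | h
    · exact absurd h hδ.ne'
    · linarith
  · -- ZONE II (`s ≥ 1/2`): near `t = 0`, `Q(t) = qHat (P(t), S t)` with `P` stationary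
    have hs14 : (1 : ℝ) / 4 < sOf z := by linarith
    have hev1 : ∀ᶠ t in 𝓝 (0 : ℝ),
        z + t • v ∈ {z : EuclideanSpace ℝ (Fin 4) | sOf z < 1 ∧ uOf z < 1 + 1 / (2 * (a + 1))} :=
      hγ.continuousAt.eventually_mem ((isOpen_embDom a).mem_nhds (by simpa using hz))
    have hev2 : ∀ᶠ t in 𝓝 (0 : ℝ), 1 / 4 < sOf (z + t • v) :=
      continuousAt_const.eventually_lt hsc.continuousAt (by simpa using hs14)
    set Pc : ℝ → ℝ := fun t => ‖lamPart (modelF a κ δ (z + t • v))‖ ^ 2 with hPc_def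
    have hP0 : Pc 0 = uOf z * (κ ^ 2 * sOf z) := by
      rw [hPc_def]
      simp only [zero_smul, add_zero]
      rw [norm_lamPart_modelF_sq hκ hz.1, pFun_of_ge κ hs14.le]
    have hQev : (fun t : ℝ => ‖muPart (modelF a κ δ (z + t • v))‖ ^ 2) =ᶠ[𝓝 0]
        fun t => shellCut (S t) * (1 + gProfile a (δ * (S t - Pc t / κ ^ 2)) - Pc t) +
          (1 - shellCut (S t)) * (δ * S t) := by
      filter_upwards [hev1, hev2] with t ht1 ht2
      have hq := qTilde_pos_of_mem_embDom ha hκ hκ2 hδ hδ2 ht1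
      rw [norm_muPart_modelF_sq hq, sq_qTilde_eq_qHat hκ.ne' ht2.le, hPc_def]
      simp only
      rw [norm_lamPart_modelF_sq hκ ht1.1, pFun_of_ge κ ht2.le, hSt t,
        show uOf (z + t • v) * (κ ^ 2 * S t) = κ ^ 2 * S t * uOf (z + t • v) by ring]
      rfl
    -- the argument of `g` at `t = 0` and the derivative `g' > 0` there
    have hE : δ * (S 0 - Pc 0 / κ ^ 2) = δ * (sOf z * (1 - uOf z)) := by
      rw [hS0, hP0]; field_simp
    have hθ1 : δ * (S 0 - Pc 0 / κ ^ 2) < 1 := by rw [hE]; exact arg_lt_one hδ hδ2 hz.1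
    have hgpos := gProfile_deriv_pos ha hθ1
    -- derivative of the right-hand side at `0`
    obtain ⟨hω, hω0⟩ := hasDerivAt_shellCut (S 0)
    have hωS : HasDerivAt (fun t => shellCut (S t)) (deriv shellCut (S 0) * (2 * cl * sOf z)) 0 :=
      hω.comp 0 hSd
    have hθ : HasDerivAt (fun t => δ * (S t - Pc t / κ ^ 2)) (δ * (2 * cl * sOf z - 0 / κ ^ 2)) 0 :=
      (hSd.fun_sub (hPc.div_const (κ ^ 2))).const_mul δ
    have hg := (hasDerivAt_gProfile a hθ1.ne).comp 0 hθ
    have hFt : HasDerivAt (fun t => 1 + gProfile a (δ * (S t - Pc t / κ ^ 2)) - Pc t)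
        (a / (2 * (1 - δ * (S 0 - Pc 0 / κ ^ 2)) ^ 2) * (δ * (2 * cl * sOf z - 0 / κ ^ 2)) - 0) 0 :=
      (hg.const_add 1).fun_sub hPc
    have h1 := hωS.fun_mul hFt
    have h2 := (hωS.const_sub 1).fun_mul (hSd.const_mul δ)
    have hder := ((h1.fun_add h2).congr_of_eventuallyEq hQev).unique hQc
    -- i.e. `2 c_λ s · [ω' (F₀ - δ s) + ω₀ g' δ + (1 - ω₀) δ] = 0`
    have key : (2 * cl * sOf z) *
        (deriv shellCut (S 0) * ((1 + gProfile a (δ * (S 0 - Pc 0 / κ ^ 2)) - Pc 0) - δ * S 0) +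
          shellCut (S 0) * (a / (2 * (1 - δ * (S 0 - Pc 0 / κ ^ 2)) ^ 2) * δ) +
          (1 - shellCut (S 0)) * δ) = 0 := by
      linear_combination hder
    -- the bracket is positive
    have hF0 : 5 / 8 ≤ 1 + gProfile a (δ * (S 0 - Pc 0 / κ ^ 2)) - Pc 0 := by
      have h := FTop_ge_of_mem_embDom ha hκ hκ2 hδ hδ2 hz
      rw [hE, hP0]
      unfold FTop at h
      linarith
    have hδS : δ * S 0 ≤ 1 / 2 := by
      rw [hS0]
      have : 0 ≤ sOf z := sq_nonneg _
      nlinarith [hz.1]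
    have hω01 := shellCut_mem (S 0)
    have hbr : 0 < deriv shellCut (S 0) * ((1 + gProfile a (δ * (S 0 - Pc 0 / κ ^ 2)) - Pc 0) - δ * S 0) +
        shellCut (S 0) * (a / (2 * (1 - δ * (S 0 - Pc 0 / κ ^ 2)) ^ 2) * δ) +
        (1 - shellCut (S 0)) * δ := by
      have t1 : 0 ≤ deriv shellCut (S 0) *
          ((1 + gProfile a (δ * (S 0 - Pc 0 / κ ^ 2)) - Pc 0) - δ * S 0) :=
        mul_nonneg hω0 (by linarith)
      have t2 : 0 ≤ shellCut (S 0) * (a / (2 * (1 - δ * (S 0 - Pc 0 / κ ^ 2)) ^ 2) * δ) :=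
        mul_nonneg hω01.1 (mul_pos hgpos hδ).le
      rcases lt_or_eq_of_le hω01.2 with hlt | heq
      · have t3 : 0 < (1 - shellCut (S 0)) * δ := mul_pos (by linarith) hδ
        linarith
      · have t3 : 0 < shellCut (S 0) * (a / (2 * (1 - δ * (S 0 - Pc 0 / κ ^ 2)) ^ 2) * δ) := by
          rw [heq, one_mul]; exact mul_pos hgpos hδ
        have t4 : 0 ≤ (1 - shellCut (S 0)) * δ := by rw [heq]; simp
        linarith
    rcases mul_eq_zero.1 key with h | h
    · linarith
    · exact absurd h hbr.ne'

/-- **THE DIFFERENTIAL OF `𝓕` IS INJECTIVE ON THE EMBEDDING DOMAIN.** [cite: MilnorHCobordism1965, §3] -/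
theorem ker_fderiv_modelF_eq_zero {a κ δ : ℝ} (ha : 0 < a) (hκ : 0 < κ) (hκ2 : κ ≤ 1 / 2)
    (hδ : 0 < δ) (hδ2 : δ ≤ 1 / 2) {z : EuclideanSpace ℝ (Fin 4)}
    (hz : z ∈ {z : EuclideanSpace ℝ (Fin 4) | sOf z < 1 ∧ uOf z < 1 + 1 / (2 * (a + 1))})
    {F' : EuclideanSpace ℝ (Fin 4) →L[ℝ] EuclideanSpace ℝ (Fin 4)}
    (hF : HasFDerivAt (modelF a κ δ) F' z) {v : EuclideanSpace ℝ (Fin 4)} (hv : F' v = 0) : v = 0 := by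
  obtain ⟨cl, cm, hvl, hvm⟩ :=
    parts_of_ker hκ hδ hδ2 (embDom_subset_modelDom ha hκ hκ2 hδ hδ2 hz) hF hv
  exact ker_eq_zero_of_mul_eq_zero hκ hz.1 hF hv hvl hvm
    (cl_mul_sOf_eq_zero ha hκ hκ2 hδ hδ2 hz hF hv hvl hvm)

/-- **The differential of `𝓕` is a linear automorphism at every point of the embedding domain.**
[cite: MilnorHCobordism1965, §3] -/
theorem exists_equiv_hasFDerivAt_modelF {a κ δ : ℝ} (ha : 0 < a) (hκ : 0 < κ) (hκ2 : κ ≤ 1 / 2)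
    (hδ : 0 < δ) (hδ2 : δ ≤ 1 / 2) {z : EuclideanSpace ℝ (Fin 4)}
    (hz : z ∈ {z : EuclideanSpace ℝ (Fin 4) | sOf z < 1 ∧ uOf z < 1 + 1 / (2 * (a + 1))}) :
    ∃ e : EuclideanSpace ℝ (Fin 4) ≃L[ℝ] EuclideanSpace ℝ (Fin 4),
      HasFDerivAt (modelF a κ δ) (e : EuclideanSpace ℝ (Fin 4) →L[ℝ] EuclideanSpace ℝ (Fin 4)) z := by
  obtain ⟨F', hF', -⟩ := hasFDerivAt_modelF hκ hδ hδ2 (embDom_subset_modelDom ha hκ hκ2 hδ hδ2 hz)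
  have hinj : Injective F' := by
    intro v w hvw
    have h : F' (v - w) = 0 := by rw [map_sub, hvw, sub_self]
    exact sub_eq_zero.1 (ker_fderiv_modelF_eq_zero ha hκ hκ2 hδ hδ2 hz hF' h)
  exact ⟨continuousLinearEquivOfInjective F' hinj,
    by rw [coe_continuousLinearEquivOfInjective]; exact hF'⟩

/-- **The Fréchet derivative of `𝓕` is injective at every point of the embedding domain** (the
form consumed by immersion criteria such as `isSmoothEmbedding_comp_coe_closedBall_of_injective_mfderiv`).
[cite: MilnorHCobordism1965, §3] -/
theorem injective_fderiv_modelF {a κ δ : ℝ} (ha : 0 < a) (hκ : 0 < κ) (hκ2 : κ ≤ 1 / 2)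
    (hδ : 0 < δ) (hδ2 : δ ≤ 1 / 2) {z : EuclideanSpace ℝ (Fin 4)}
    (hz : z ∈ {z : EuclideanSpace ℝ (Fin 4) | sOf z < 1 ∧ uOf z < 1 + 1 / (2 * (a + 1))}) :
    Injective (fderiv ℝ (modelF a κ δ) z) := by
  obtain ⟨e, he⟩ := exists_equiv_hasFDerivAt_modelF ha hκ hκ2 hδ hδ2 hz
  rw [he.fderiv]
  exact e.injective

end Zones

/-! ### §2 The open smooth embedding -/

section Embedding

/-- **`𝓕` RESTRICTED TO THE EMBEDDING DOMAIN IS A DIFFEOMORPHISM ONTO AN OPEN SET**: an open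
partial homeomorphism of `ℝ⁴` with source `{s < 1, u < 1 + 1/(2(a+1))}`, underlying map `𝓕`,
`C^∞` with `C^∞` inverse. [cite: LeeSmoothManifolds2013, Thm. 4.5] -/
theorem exists_openPartialHomeomorph_modelF {a κ δ : ℝ} (ha : 0 < a) (hκ : 0 < κ) (hκ2 : κ ≤ 1 / 2)
    (hδ : 0 < δ) (hδ2 : δ ≤ 1 / 2) :
    ∃ Φ : OpenPartialHomeomorph (EuclideanSpace ℝ (Fin 4)) (EuclideanSpace ℝ (Fin 4)),
      Φ.source = {z : EuclideanSpace ℝ (Fin 4) | sOf z < 1 ∧ uOf z < 1 + 1 / (2 * (a + 1))} ∧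
      (∀ z, Φ z = modelF a κ δ z) ∧ ContDiffOn ℝ ∞ Φ Φ.source ∧ ContDiffOn ℝ ∞ Φ.symm Φ.target :=
  exists_openPartialHomeomorph_of_injOn (isOpen_embDom a) (contDiffOn_modelF_embDom ha hκ hκ2 hδ hδ2)
    (injOn_modelF_embDom ha hκ hκ2 hδ hδ2) fun _ hz => exists_equiv_hasFDerivAt_modelF ha hκ hκ2 hδ hδ2 hz

/-- **`𝓕` is an open map on the embedding domain**: images of open subsets are open.
[cite: LeeSmoothManifolds2013, Thm. 4.5] -/
theorem isOpen_image_modelF {a κ δ : ℝ} (ha : 0 < a) (hκ : 0 < κ) (hκ2 : κ ≤ 1 / 2)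
    (hδ : 0 < δ) (hδ2 : δ ≤ 1 / 2) {O : Set (EuclideanSpace ℝ (Fin 4))} (hO : IsOpen O)
    (hOsub : O ⊆ {z : EuclideanSpace ℝ (Fin 4) | sOf z < 1 ∧ uOf z < 1 + 1 / (2 * (a + 1))}) :
    IsOpen (modelF a κ δ '' O) := by
  obtain ⟨Φ, hsrc, hΦ, -, -⟩ := exists_openPartialHomeomorph_modelF ha hκ hκ2 hδ hδ2
  have h : modelF a κ δ '' O = Φ '' O := by
    refine image_congr fun x _ => (hΦ x).symm
  rw [h]
  exact Φ.isOpen_image_of_subset_source hO (by rw [hsrc]; exact hOsub)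

/-- **A smooth inverse on the open image**: there is `G : ℝ⁴ → ℝ⁴`, `C^∞` on the open set
`𝓕 '' Ω` (`Ω` the embedding domain), with `G (𝓕 z) = z` for `z ∈ Ω` (V5 report §3.1 (F-inv), in
the form "`𝓕` has a `C^∞` inverse on its open image"). [cite: LeeSmoothManifolds2013, Thm. 4.5] -/
theorem exists_contDiffOn_leftInverse_modelF {a κ δ : ℝ} (ha : 0 < a) (hκ : 0 < κ) (hκ2 : κ ≤ 1 / 2)
    (hδ : 0 < δ) (hδ2 : δ ≤ 1 / 2) :
    ∃ G : EuclideanSpace ℝ (Fin 4) → EuclideanSpace ℝ (Fin 4),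
      IsOpen (modelF a κ δ '' {z : EuclideanSpace ℝ (Fin 4) | sOf z < 1 ∧ uOf z < 1 + 1 / (2 * (a + 1))}) ∧
      ContDiffOn ℝ ∞ G
        (modelF a κ δ '' {z : EuclideanSpace ℝ (Fin 4) | sOf z < 1 ∧ uOf z < 1 + 1 / (2 * (a + 1))}) ∧
      ∀ z ∈ {z : EuclideanSpace ℝ (Fin 4) | sOf z < 1 ∧ uOf z < 1 + 1 / (2 * (a + 1))},
        G (modelF a κ δ z) = z := by
  obtain ⟨Φ, hsrc, hΦ, -, hsymm⟩ := exists_openPartialHomeomorph_modelF ha hκ hκ2 hδ hδ2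
  have himg : modelF a κ δ '' {z : EuclideanSpace ℝ (Fin 4) | sOf z < 1 ∧ uOf z < 1 + 1 / (2 * (a + 1))} =
      Φ.target := by
    rw [← hsrc, ← Φ.image_source_eq_target]
    exact image_congr fun x _ => (hΦ x).symm
  refine ⟨Φ.symm, by rw [himg]; exact Φ.open_target, by rw [himg]; exact hsymm, fun z hz => ?_⟩
  rw [← hΦ]
  exact Φ.left_inv (by rw [hsrc]; exact hz)

/-- **Injectivity of the manifold derivative** (`mfderiv` for the model `𝓘(ℝ, ℝ⁴) = 𝓡 4`), the
form consumed by `isSmoothEmbedding_comp_coe_closedBall_of_injective_mfderiv`-type criteria.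
[cite: MilnorHCobordism1965, §3] -/
theorem injective_mfderiv_modelF {a κ δ : ℝ} (ha : 0 < a) (hκ : 0 < κ) (hκ2 : κ ≤ 1 / 2)
    (hδ : 0 < δ) (hδ2 : δ ≤ 1 / 2) {z : EuclideanSpace ℝ (Fin 4)}
    (hz : z ∈ {z : EuclideanSpace ℝ (Fin 4) | sOf z < 1 ∧ uOf z < 1 + 1 / (2 * (a + 1))}) :
    Injective (mfderiv 𝓘(ℝ, EuclideanSpace ℝ (Fin 4)) 𝓘(ℝ, EuclideanSpace ℝ (Fin 4)) (modelF a κ δ) z) := by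
  rw [mfderiv_eq_fderiv]
  exact injective_fderiv_modelF ha hκ hκ2 hδ hδ2 hz

/-- **THE MODEL OF THE DUAL HANDLE EMBEDDING IS A SMOOTH EMBEDDING WITH OPEN RANGE** on every
non-empty open subset `U` of the embedding domain `{s < 1, u < 1 + 1/(2(a+1))}` (`0 < a`,
`0 < κ ≤ 1/2`, `0 < δ ≤ 1/2`): an open topological embedding, smooth, whose inverse (the restriction
of the smooth inverse of `exists_openPartialHomeomorph_modelF`) is smooth on the range — the
criterion `isSmoothEmbedding_of_contMDiffOn_symm`. [cite: LeeSmoothManifolds2013, Prop. 5.2] -/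
theorem isSmoothEmbedding_modelF {a κ δ : ℝ} (ha : 0 < a) (hκ : 0 < κ) (hκ2 : κ ≤ 1 / 2)
    (hδ : 0 < δ) (hδ2 : δ ≤ 1 / 2) (U : TopologicalSpace.Opens (EuclideanSpace ℝ (Fin 4))) [Nonempty U]
    (hU : (U : Set (EuclideanSpace ℝ (Fin 4))) ⊆
      {z : EuclideanSpace ℝ (Fin 4) | sOf z < 1 ∧ uOf z < 1 + 1 / (2 * (a + 1))}) :
    Manifold.IsSmoothEmbedding 𝓘(ℝ, EuclideanSpace ℝ (Fin 4)) 𝓘(ℝ, EuclideanSpace ℝ (Fin 4)) ∞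
        (fun x : U => modelF a κ δ x) ∧
      IsOpen (range fun x : U => modelF a κ δ x) := by
  obtain ⟨Φ, hsrc, hΦ, -, hsymm⟩ := exists_openPartialHomeomorph_modelF ha hκ hκ2 hδ hδ2
  set jU : U → EuclideanSpace ℝ (Fin 4) := fun x => modelF a κ δ x with hjU
  have hUsrc : (U : Set (EuclideanSpace ℝ (Fin 4))) ⊆ Φ.source := by rw [hsrc]; exact hU
  -- smoothness, injectivity, openness
  have hsm : ContMDiff 𝓘(ℝ, EuclideanSpace ℝ (Fin 4)) 𝓘(ℝ, EuclideanSpace ℝ (Fin 4)) ∞ jU :=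
    (contMDiffOn_iff_contDiffOn.2 (contDiffOn_modelF_embDom ha hκ hκ2 hδ hδ2)).comp_contMDiff
      contMDiff_subtype_val fun x => hU x.2
  have hinj : Injective jU := fun x y hxy =>
    Subtype.ext (injOn_modelF_embDom ha hκ hκ2 hδ hδ2 (hU x.2) (hU y.2) hxy)
  have hopen : IsOpenMap jU := by
    intro O hO
    obtain ⟨O', hO', rfl⟩ := isOpen_induced_iff.1 hO
    have h1 : jU '' (Subtype.val ⁻¹' O') = modelF a κ δ '' (O' ∩ (U : Set _)) := by
      ext p
      simp only [mem_image, mem_preimage, mem_inter_iff]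
      constructor
      · rintro ⟨x, hx, rfl⟩
        exact ⟨x.1, ⟨hx, x.2⟩, rfl⟩
      · rintro ⟨y, ⟨hy, hyU⟩, rfl⟩
        exact ⟨⟨y, hyU⟩, hy, rfl⟩
    rw [h1]
    exact isOpen_image_modelF ha hκ hκ2 hδ hδ2 (hO'.inter U.isOpen) fun x hx => hU hx.2
  have hk : IsOpenEmbedding jU := .of_continuous_injective_isOpenMap hsm.continuous hinj hopen
  refine ⟨isSmoothEmbedding_of_contMDiffOn_symm hk hsm ?_, hk.isOpen_range⟩
  -- the inverse on the range is `Φ.symm`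
  have hrange : range jU ⊆ Φ.target := by
    rintro _ ⟨x, rfl⟩
    show modelF a κ δ x ∈ Φ.target
    rw [← hΦ]
    exact Φ.map_source (hUsrc x.2)
  have hcomp : ContMDiffOn 𝓘(ℝ, EuclideanSpace ℝ (Fin 4)) 𝓘(ℝ, EuclideanSpace ℝ (Fin 4)) ∞ Φ.symm
      (range jU) := (contMDiffOn_iff_contDiffOn.2 hsymm).mono hrange
  have hinv : ∀ x : U, ((hk.toOpenPartialHomeomorph jU).symm (jU x) : EuclideanSpace ℝ (Fin 4)) =
      Φ.symm (jU x) := fun x => by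
    rw [IsOpenEmbedding.toOpenPartialHomeomorph_left_inv]
    show (x : EuclideanSpace ℝ (Fin 4)) = Φ.symm (modelF a κ δ x)
    rw [← hΦ, Φ.left_inv (hUsrc x.2)]
  intro p hp
  rw [← ContMDiffWithinAt.subtypeVal_comp_iff]
  refine (hcomp p hp).congr (fun q hq => ?_) ?_
  · obtain ⟨x, rfl⟩ := hq
    exact hinv x
  · obtain ⟨x, rfl⟩ := hp
    exact hinv x

/-- **Registered helper `helper_isSmoothEmbedding_modelF` (brick (F-emb)/(F-inv) of T3b, sub-goal
of NF6 `stub_steinRealisation`, wave 3, lead c5): the model of the dual handle embedding is a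
smooth embedding with open range on every non-empty open subset of the embedding domain
`{s < 1, u < 1 + 1/(2(a+1))} ⊇ {‖z‖ ≤ 1, ‖z_λ‖ < 1}`.** [cite: LeeSmoothManifolds2013, Prop. 5.2] -/
theorem helper_isSmoothEmbedding_modelF : ∀ {a κ δ : ℝ}, 0 < a → 0 < κ → κ ≤ 1 / 2 → 0 < δ → δ ≤ 1 / 2 → ∀ (U : TopologicalSpace.Opens (EuclideanSpace ℝ (Fin 4))) [Nonempty U], (U : Set (EuclideanSpace ℝ (Fin 4))) ⊆ {z : EuclideanSpace ℝ (Fin 4) | Summit.SmoothPoincare4.SmoothPoincare4.Theorems.AcyclicBisectionExists.ModpBraidOrbits.sOf z < 1 ∧ Summit.SmoothPoincare4.SmoothPoincare4.Theorems.AcyclicBisectionExists.ModpBraidOrbits.uOf z < 1 + 1 / (2 * (a + 1))} → Manifold.IsSmoothEmbedding 𝓘(ℝ, EuclideanSpace ℝ (Fin 4)) 𝓘(ℝ, EuclideanSpace ℝ (Fin 4)) ∞ (fun x : U => Summit.SmoothPoincare4.SmoothPoincare4.Theorems.AcyclicBisectionExists.ModpBraidOrbits.modelF a κ δ x) ∧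 IsOpen (Set.range fun x : U => Summit.SmoothPoincare4.SmoothPoincare4.Theorems.AcyclicBisectionExists.ModpBraidOrbits.modelF a κ δ x) :=
  fun ha hκ hκ2 hδ hδ2 U _ hU => isSmoothEmbedding_modelF ha hκ hκ2 hδ hδ2 U hU

end Embedding

end Summit.SmoothPoincare4.SmoothPoincare4.Theorems.AcyclicBisectionExists.ModpBraidOrbits

end
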